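import Literature.Geometry.Lorentzian.ParametricAnnulusGluingReduction
import Literature.Geometry.Lorentzian.InitialDataInterpolation
import HarnessLib

/-!
# The coordinate core of `ChruscielDelay_parametricAnnulusGluing`: cut-off interpolation, and the
# reduction to KID exhaustion plus the Chruściel–Delay theorem on a compact annulus

Topic `Literature/Geometry/Lorentzian`. Everything here is PROVED; no definition, no statement of
`Prop` type is introduced (the two analytic statements below are HYPOTHESES of the reduction
theorem, spelled out in place; they are not vendored as named facts, D-0026).

`ParametricAnnulusGluingReduction.lean` proves `(A) ⟹ ChruscielDelay_parametricAnnulusGluing`,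
`(A)` being the parametric gluing statement for a smooth one-parameter family `(S c, T c)` of
coordinate vacuum data on the open annulus `A = {R₁ < ‖z‖ < R₂}` of `E3`, KID-free at `c = 0`.
The printed proof of `(A)` (Chruściel–Delay 2003, §8.6, pp. 52–54, with Thm. 5.9, Prop. 5.10,
Cor. 5.11; Chruściel–Isenberg–Pollack 2005, §§2–4) has three steps, of which this file PROVES the
first and isolates the other two:

* `(I)` **cut-off interpolation** (`exists_interpolatedCoordFamily`, proved): with a radial cut-off
  `χ = 1` on `{‖z‖ ≤ a'}`, `χ = 0` on `{b' ≤ ‖z‖}` (`radialCutoff`, `InitialDataInterpolation.lean`),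
  the family `(G c, K c) := (χ S c + (1 − χ) S 0, χ T c + (1 − χ) T 0)` is jointly `C^∞` on
  `ℝ¹ × A`, symmetric, `G c` positive definite (convex combination), `= (S c, T c)` inside `a'`,
  `= (S 0, T 0)` beyond `b'` and at `c = 0`, hence coordinate-vacuum off the closed shell
  `{a' ≤ ‖z‖ ≤ b'}` and at `c = 0` (locality of `hamAt`, `momFn`, `CoordConstraintCongr.lean`);
* `(K)` **KID exhaustion** (hypothesis): smooth Riemannian coordinate vacuum data without KIDs on
  the open annulus `A` have no KIDs on some open sub-annulus `{a < ‖z‖ < b}`, `R₁ < a < b < R₂`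
  (the KIDs on a connected open set are the Cauchy data of the Killing fields of the vacuum
  development, Moncrief 1975, §III, hence determined by finitely many derivatives at one point and
  finite-dimensional; an increasing exhaustion of `A` by sub-annuli then has eventually constant,
  hence — by the hypothesis — trivial KID spaces);
* `(E)` **the Chruściel–Delay theorem on the compact annulus `Ā' = {a ≤ ‖z‖ ≤ b}`, parametric
  form** (hypothesis; Chruściel–Delay 2003, Thm. 5.9 with Prop. 5.10 and Cor. 5.11: for the vacuum
  KID-free base data `(K₀, g₀) = (K 0, G 0)|_{Ā'}`, data `(K c, G c)|_{Ā'}` close to it and the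
  small source `−(J, ρ)(K c, G c)` supported in `{a' ≤ ‖z‖ ≤ b'} ⋐ (a, b)`, a small solution of the
  constraint equations in `x²C^∞_{x²,e^{s/x}} × x⁴C^∞_{x²,e^{s/x}}`, smoothly extended by zero across
  `∂Ā'`; 2004, Thm. 6.6: `C^∞` dependence on `(K, g, δJ, δρ)`, hence on `c`; §8.6: "one obtains
  an extension for `λ` small enough when `P*` has no kernel"): there are `r > 0` and a family
  `(G' c, K' c)`, `c ∈ ball 0 r`, jointly `C^∞` on `ball 0 r × A`, symmetric, positive,
  coordinate-vacuum on ALL of `A`, through `(G 0, K 0)`, and equal to `(G c, K c)` off `Ā'`.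

Main result: `ChruscielDelay_parametricAnnulusGluing_of_kidExhaustion_of_compactCore`:
`(K) ∧ (E) ⟹ ChruscielDelay_parametricAnnulusGluing` (through `(A)`, with `ρ₁ = a`, `ρ₂ = b`).

## References

* P. T. Chruściel, E. Delay, Mém. Soc. Math. Fr. 94 (2003), Thm. 5.9, Prop. 5.10, Cor. 5.11,
  §8.6 (pp. 52–54). [ChruscielDelay2003]
* P. T. Chruściel, E. Delay, J. Geom. Phys. 51 (2004), Thm. 6.6. [ChruscielDelay2004]
* P. T. Chruściel, J. Isenberg, D. Pollack, Comm. Math. Phys. 257 (2005), §§2–4.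
  [ChruscielIsenbergPollack2004]
* V. Moncrief, J. Math. Phys. 16 (1975) 493–498, §III. [Moncrief1975]
* R. Beig, P. T. Chruściel, *Killing initial data*, Class. Quantum Grav. 14 (1997) A83–A92.
-/

noncomputable section

set_option maxSynthPendingDepth 3

open Set Function Filter TopologicalSpace Module Metric
open scoped ContDiff Topology

namespace Literature.Geometry.Lorentzian

/-! ### `(I)` Cut-off interpolation of a family of coordinate data with its base member -/

/-- **Cut-off interpolation of a one-parameter family of coordinate data with its base member.**
Let `(S c, T c)`, `c ∈ ℝ¹`, be coordinate fields on `E3`, jointly `C^∞` on `ℝ¹ × A`,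
`A = {R₁ < ‖z‖ < R₂}`, symmetric, `S c` positive definite and coordinate-vacuum on `A`, and let
`R₁ < a' < b'` (`0 < R₁`). Then there is a family `(G c, K c)` — namely
`(χ S c + (1 − χ) S 0, χ T c + (1 − χ) T 0)` for the radial cut-off `χ = radialCutoff a' b'` —
jointly `C^∞` on `ℝ¹ × A`, symmetric, `G c` positive definite on `A`, with `(G 0, K 0) = (S 0, T 0)`
(everywhere), `(G c, K c) = (S c, T c)` on `{‖z‖ ≤ a'}` and `= (S 0, T 0)` on `{b' ≤ ‖z‖}`, hence
coordinate-vacuum on `A` at `c = 0` and, for every `c`, at the points of `A` with `‖z‖ < a'` or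
`b' < ‖z‖` (the constraint operators are local). Chruściel–Isenberg–Pollack 2005, §2; Corvino
2000, §4; Li–Mei 2020, proof of Prop. 4.1 (the interpolation `φ ḡ + (1 − φ) ḡ_{m,a}`). [folklore] -/
theorem exists_interpolatedCoordFamily {ι : Type*} [Fintype ι] (b₀ : Basis ι ℝ E3)
    {R₁ a' b' R₂ : ℝ} (hR₁ : 0 < R₁) (ha' : R₁ < a') (hab : a' < b')
    (S T : EuclideanSpace ℝ (Fin 1) → E3 → E3 →L[ℝ] E3 →L[ℝ] ℝ)
    (hSs : ContDiffOn ℝ ∞ (fun p : EuclideanSpace ℝ (Fin 1) × E3 ↦ S p.1 p.2)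
      ((univ : Set (EuclideanSpace ℝ (Fin 1))) ×ˢ {z : E3 | R₁ < ‖z‖ ∧ ‖z‖ < R₂}))
    (hTs : ContDiffOn ℝ ∞ (fun p : EuclideanSpace ℝ (Fin 1) × E3 ↦ T p.1 p.2)
      ((univ : Set (EuclideanSpace ℝ (Fin 1))) ×ˢ {z : E3 | R₁ < ‖z‖ ∧ ‖z‖ < R₂}))
    (hsym : ∀ c, ∀ z : E3, R₁ < ‖z‖ → ‖z‖ < R₂ → ∀ v w : E3,
      S c z v w = S c z w v ∧ T c z v w = T c z w v)
    (hpos : ∀ c, ∀ z : E3, R₁ < ‖z‖ → ‖z‖ < R₂ → ∀ v : E3, v ≠ 0 → 0 < S c z v v)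
    (hcv : ∀ c, ∀ z : E3, R₁ < ‖z‖ → ‖z‖ < R₂ →
      MetricCoord.hamAt (S c) (T c) z = 0 ∧ ∀ Z : E3, MetricCoord.momFn b₀ (S c) (T c) z Z = 0) :
    ∃ G K : EuclideanSpace ℝ (Fin 1) → E3 → E3 →L[ℝ] E3 →L[ℝ] ℝ,
      ContDiffOn ℝ ∞ (fun p : EuclideanSpace ℝ (Fin 1) × E3 ↦ G p.1 p.2)
        ((univ : Set (EuclideanSpace ℝ (Fin 1))) ×ˢ {z : E3 | R₁ < ‖z‖ ∧ ‖z‖ < R₂}) ∧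
      ContDiffOn ℝ ∞ (fun p : EuclideanSpace ℝ (Fin 1) × E3 ↦ K p.1 p.2)
        ((univ : Set (EuclideanSpace ℝ (Fin 1))) ×ˢ {z : E3 | R₁ < ‖z‖ ∧ ‖z‖ < R₂}) ∧
      (∀ c, ∀ z : E3, R₁ < ‖z‖ → ‖z‖ < R₂ → ∀ v w : E3,
        G c z v w = G c z w v ∧ K c z v w = K c z w v) ∧
      (∀ c, ∀ z : E3, R₁ < ‖z‖ → ‖z‖ < R₂ → ∀ v : E3, v ≠ 0 → 0 < G c z v v) ∧
      (∀ z : E3, G 0 z = S 0 z ∧ K 0 z = T 0 z) ∧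
      (∀ c, ∀ z : E3, ‖z‖ ≤ a' → G c z = S c z ∧ K c z = T c z) ∧
      (∀ c, ∀ z : E3, b' ≤ ‖z‖ → G c z = S 0 z ∧ K c z = T 0 z) ∧
      (∀ z : E3, R₁ < ‖z‖ → ‖z‖ < R₂ →
        MetricCoord.hamAt (G 0) (K 0) z = 0 ∧ ∀ Z : E3, MetricCoord.momFn b₀ (G 0) (K 0) z Z = 0) ∧
      (∀ c, ∀ z : E3, R₁ < ‖z‖ → ‖z‖ < R₂ → (‖z‖ < a' ∨ b' < ‖z‖) →
        MetricCoord.hamAt (G c) (K c) z = 0 ∧ ∀ Z : E3, MetricCoord.momFn b₀ (G c) (K c) z Z = 0) := by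
  -- the cut-off: smooth, values in `[0, 1]`, `= 1` on `{‖z‖ ≤ a'}`, `= 0` on `{b' ≤ ‖z‖}`
  obtain ⟨χ, hχs, hχ0, hχ1, hχone, hχzero⟩ : ∃ χ : E3 → ℝ, ContDiff ℝ ∞ χ ∧ (∀ z, 0 ≤ χ z) ∧
      (∀ z, χ z ≤ 1) ∧ (∀ z : E3, ‖z‖ ≤ a' → χ z = 1) ∧ (∀ z : E3, b' ≤ ‖z‖ → χ z = 0) :=
    ⟨radialCutoff a' b', contDiff_radialCutoff a' b', radialCutoff_nonneg a' b',
      radialCutoff_le_one a' b', fun z hz ↦ radialCutoff_of_norm_le (by linarith) hab hz,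
      fun z hz ↦ radialCutoff_of_le_norm (by linarith) hab hz⟩
  -- algebra of the interpolation
  have hbase : ∀ (t : ℝ) (x : E3 →L[ℝ] E3 →L[ℝ] ℝ), t • x + (1 - t) • x = x := fun t x ↦ by
    rw [← add_smul, add_sub_cancel, one_smul]
  have hone : ∀ (x y : E3 →L[ℝ] E3 →L[ℝ] ℝ), (1 : ℝ) • x + (1 - 1 : ℝ) • y = x := fun x y ↦ by
    rw [one_smul, sub_self, zero_smul, add_zero]
  have hzero : ∀ (x y : E3 →L[ℝ] E3 →L[ℝ] ℝ), (0 : ℝ) • x + (1 - 0 : ℝ) • y = y := fun x y ↦ by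
    rw [zero_smul, sub_zero, one_smul, zero_add]
  refine ⟨fun c z ↦ χ z • S c z + (1 - χ z) • S 0 z, fun c z ↦ χ z • T c z + (1 - χ z) • T 0 z,
    ?_, ?_, ?_, ?_, fun z ↦ ⟨hbase _ _, hbase _ _⟩, ?_, ?_, ?_, ?_⟩
  · -- joint smoothness
    have hχ2 : ContDiffOn ℝ ∞ (fun p : EuclideanSpace ℝ (Fin 1) × E3 ↦ χ p.2)
        ((univ : Set (EuclideanSpace ℝ (Fin 1))) ×ˢ {z : E3 | R₁ < ‖z‖ ∧ ‖z‖ < R₂}) :=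
      (hχs.comp contDiff_snd).contDiffOn
    have hS0 : ContDiffOn ℝ ∞ (fun p : EuclideanSpace ℝ (Fin 1) × E3 ↦ S 0 p.2)
        ((univ : Set (EuclideanSpace ℝ (Fin 1))) ×ˢ {z : E3 | R₁ < ‖z‖ ∧ ‖z‖ < R₂}) :=
      hSs.comp (contDiffOn_const.prodMk contDiffOn_snd) fun p hp ↦ ⟨mem_univ _, hp.2⟩
    exact (hχ2.smul hSs).add ((contDiffOn_const.sub hχ2).smul hS0)
  · have hχ2 : ContDiffOn ℝ ∞ (fun p : EuclideanSpace ℝ (Fin 1) × E3 ↦ χ p.2)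
        ((univ : Set (EuclideanSpace ℝ (Fin 1))) ×ˢ {z : E3 | R₁ < ‖z‖ ∧ ‖z‖ < R₂}) :=
      (hχs.comp contDiff_snd).contDiffOn
    have hT0 : ContDiffOn ℝ ∞ (fun p : EuclideanSpace ℝ (Fin 1) × E3 ↦ T 0 p.2)
        ((univ : Set (EuclideanSpace ℝ (Fin 1))) ×ˢ {z : E3 | R₁ < ‖z‖ ∧ ‖z‖ < R₂}) :=
      hTs.comp (contDiffOn_const.prodMk contDiffOn_snd) fun p hp ↦ ⟨mem_univ _, hp.2⟩
    exact (hχ2.smul hTs).add ((contDiffOn_const.sub hχ2).smul hT0)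
  · -- symmetry
    intro c z hz1 hz2 v w
    obtain ⟨hS, hT⟩ := hsym c z hz1 hz2 v w
    obtain ⟨hS0, hT0⟩ := hsym 0 z hz1 hz2 v w
    simp only [_root_.add_apply, _root_.smul_apply, hS, hT, hS0, hT0]
    exact ⟨trivial, trivial⟩
  · -- positivity (a convex combination of positive definite forms)
    intro c z hz1 hz2 v hv
    have ha := hpos c z hz1 hz2 v hv
    have hb := hpos 0 z hz1 hz2 v hv
    have h0 := hχ0 z
    have h1 := hχ1 z
    simp only [_root_.add_apply, _root_.smul_apply, smul_eq_mul]
    rcases h0.eq_or_lt with h | h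
    · rw [← h]
      simpa using hb
    · nlinarith [mul_pos h ha, mul_nonneg (sub_nonneg.2 h1) hb.le]
  · -- inside `a'`
    intro c z hz
    simp only [hχone z hz]
    exact ⟨hone _ _, hone _ _⟩
  · -- beyond `b'`
    intro c z hz
    simp only [hχzero z hz]
    exact ⟨hzero _ _, hzero _ _⟩
  · -- coordinate vacuum at `c = 0` (the base member, everywhere equal to `(S 0, T 0)`)
    intro z hz1 hz2
    have hevG : (fun z ↦ χ z • S 0 z + (1 - χ z) • S 0 z) =ᶠ[𝓝 z] S 0 :=
      Eventually.of_forall fun w ↦ hbase _ _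
    have hevK : (fun z ↦ χ z • T 0 z + (1 - χ z) • T 0 z) =ᶠ[𝓝 z] T 0 :=
      Eventually.of_forall fun w ↦ hbase _ _
    obtain ⟨hh, hmo⟩ := hcv 0 z hz1 hz2
    refine ⟨?_, fun Z ↦ ?_⟩
    · rw [MetricCoord.hamAt_congr_of_eventuallyEq hevG hevK]
      exact hh
    · rw [MetricCoord.momFn_congr_of_eventuallyEq b₀ hevG hevK Z]
      exact hmo Z
  · -- coordinate vacuum off the shell `{a' ≤ ‖z‖ ≤ b'}`
    intro c z hz1 hz2 hz
    rcases hz with hz | hz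
    · have hO : IsOpen {w : E3 | ‖w‖ < a'} := isOpen_lt continuous_norm continuous_const
      have hevG : (fun z ↦ χ z • S c z + (1 - χ z) • S 0 z) =ᶠ[𝓝 z] S c := by
        filter_upwards [hO.mem_nhds hz] with w hw
        rw [hχone w (le_of_lt hw)]
        exact hone _ _
      have hevK : (fun z ↦ χ z • T c z + (1 - χ z) • T 0 z) =ᶠ[𝓝 z] T c := by
        filter_upwards [hO.mem_nhds hz] with w hw
        rw [hχone w (le_of_lt hw)]
        exact hone _ _
      obtain ⟨hh, hmo⟩ := hcv c z hz1 hz2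
      refine ⟨?_, fun Z ↦ ?_⟩
      · rw [MetricCoord.hamAt_congr_of_eventuallyEq hevG hevK]
        exact hh
      · rw [MetricCoord.momFn_congr_of_eventuallyEq b₀ hevG hevK Z]
        exact hmo Z
    · have hO : IsOpen {w : E3 | b' < ‖w‖} := isOpen_lt continuous_const continuous_norm
      have hevG : (fun z ↦ χ z • S c z + (1 - χ z) • S 0 z) =ᶠ[𝓝 z] S 0 := by
        filter_upwards [hO.mem_nhds hz] with w hw
        rw [hχzero w (le_of_lt hw)]
        exact hzero _ _
      have hevK : (fun z ↦ χ z • T c z + (1 - χ z) • T 0 z) =ᶠ[𝓝 z] T 0 := by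
        filter_upwards [hO.mem_nhds hz] with w hw
        rw [hχzero w (le_of_lt hw)]
        exact hzero _ _
      obtain ⟨hh, hmo⟩ := hcv 0 z hz1 hz2
      refine ⟨?_, fun Z ↦ ?_⟩
      · rw [MetricCoord.hamAt_congr_of_eventuallyEq hevG hevK]
        exact hh
      · rw [MetricCoord.momFn_congr_of_eventuallyEq b₀ hevG hevK Z]
        exact hmo Z

/-! ### `(K) ∧ (E) ⟹` the fact -/

/-- **`ChruscielDelay_parametricAnnulusGluing` from KID exhaustion `(K)` and the Chruściel–Delay
theorem on a compact annulus `(E)`** (see the module docstring for both statements and their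
sources). Proof: by `ChruscielDelay_parametricAnnulusGluing_of_coordCore` it suffices to prove the
coordinate core `(A)`; given its data `(S, T)` on `A = {R₁ < ‖z‖ < R₂}`, `(K)` supplies a KID-free
sub-annulus `{a < ‖z‖ < b}` for `(S 0, T 0)`; with `a < a' < b' < b` the interpolated family
`(G, K)` of `exists_interpolatedCoordFamily` satisfies the hypotheses of `(E)` (its base member IS
`(S 0, T 0)`, so it has the same KIDs on the sub-annulus — the adjoint operators are local,
`CoordConstraintCongr.lean`); the family `(G', K')` produced by `(E)` is the one required by `(A)`
with `ρ₁ = a`, `ρ₂ = b`: on `{R₁ < ‖z‖ < a}` it is `G c = S c` (`χ = 1`), on `{b < ‖z‖ < R₂}` it is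
`G c = S 0` (`χ = 0`), and `G' 0 = G 0 = S 0`. Neither `(K)` nor `(E)` is proved in the tree.
[cite: ChruscielDelay2003, Thm. 5.9, Prop. 5.10, Cor. 5.11 and §8.6] -/
theorem ChruscielDelay_parametricAnnulusGluing_of_kidExhaustion_of_compactCore {ι : Type}
    [Fintype ι] (b₀ : Basis ι ℝ E3)
    (hK : ∀ (R₁ R₂ : ℝ), 0 < R₁ → R₁ < R₂ →
      ∀ (G K : E3 → E3 →L[ℝ] E3 →L[ℝ] ℝ),
        ContDiffOn ℝ ∞ G {z : E3 | R₁ < ‖z‖ ∧ ‖z‖ < R₂} →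
        ContDiffOn ℝ ∞ K {z : E3 | R₁ < ‖z‖ ∧ ‖z‖ < R₂} →
        (∀ z : E3, R₁ < ‖z‖ → ‖z‖ < R₂ → ∀ v w : E3, G z v w = G z w v ∧ K z v w = K z w v) →
        (∀ z : E3, R₁ < ‖z‖ → ‖z‖ < R₂ → ∀ v : E3, v ≠ 0 → 0 < G z v v) →
        (∀ z : E3, R₁ < ‖z‖ → ‖z‖ < R₂ →
          MetricCoord.hamAt G K z = 0 ∧ ∀ Z : E3, MetricCoord.momFn b₀ G K z Z = 0) →
        (∀ (N : E3 → ℝ) (Y : E3 → E3),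
          ContDiffOn ℝ ∞ N {z : E3 | R₁ < ‖z‖ ∧ ‖z‖ < R₂} →
          ContDiffOn ℝ ∞ Y {z : E3 | R₁ < ‖z‖ ∧ ‖z‖ < R₂} →
          (∀ z : E3, R₁ < ‖z‖ → ‖z‖ < R₂ →
            MetricCoord.adjHamG G K N z + MetricCoord.adjMomGS G K Y z = 0 ∧
            MetricCoord.adjHamK G K N z + MetricCoord.adjMomKS G Y z = 0) →
          ∀ z : E3, R₁ < ‖z‖ → ‖z‖ < R₂ → N z = 0 ∧ Y z = 0) →
        ∃ a b : ℝ, R₁ < a ∧ a < b ∧ b < R₂ ∧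
          ∀ (N : E3 → ℝ) (Y : E3 → E3),
            ContDiffOn ℝ ∞ N {z : E3 | a < ‖z‖ ∧ ‖z‖ < b} →
            ContDiffOn ℝ ∞ Y {z : E3 | a < ‖z‖ ∧ ‖z‖ < b} →
            (∀ z : E3, a < ‖z‖ → ‖z‖ < b →
              MetricCoord.adjHamG G K N z + MetricCoord.adjMomGS G K Y z = 0 ∧
              MetricCoord.adjHamK G K N z + MetricCoord.adjMomKS G Y z = 0) →
            ∀ z : E3, a < ‖z‖ → ‖z‖ < b → N z = 0 ∧ Y z = 0)
    (hE : ∀ (R₁ a a' b' b R₂ : ℝ), 0 < R₁ → R₁ < a → a < a' → a' < b' → b' < b → b < R₂ →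
      ∀ (G K : EuclideanSpace ℝ (Fin 1) → E3 → E3 →L[ℝ] E3 →L[ℝ] ℝ),
        ContDiffOn ℝ ∞ (fun p : EuclideanSpace ℝ (Fin 1) × E3 ↦ G p.1 p.2)
          ((univ : Set (EuclideanSpace ℝ (Fin 1))) ×ˢ {z : E3 | R₁ < ‖z‖ ∧ ‖z‖ < R₂}) →
        ContDiffOn ℝ ∞ (fun p : EuclideanSpace ℝ (Fin 1) × E3 ↦ K p.1 p.2)
          ((univ : Set (EuclideanSpace ℝ (Fin 1))) ×ˢ {z : E3 | R₁ < ‖z‖ ∧ ‖z‖ < R₂}) →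
        (∀ c, ∀ z : E3, R₁ < ‖z‖ → ‖z‖ < R₂ → ∀ v w : E3,
          G c z v w = G c z w v ∧ K c z v w = K c z w v) →
        (∀ c, ∀ z : E3, R₁ < ‖z‖ → ‖z‖ < R₂ → ∀ v : E3, v ≠ 0 → 0 < G c z v v) →
        (∀ z : E3, R₁ < ‖z‖ → ‖z‖ < R₂ →
          MetricCoord.hamAt (G 0) (K 0) z = 0 ∧
            ∀ Z : E3, MetricCoord.momFn b₀ (G 0) (K 0) z Z = 0) →
        (∀ c, ∀ z : E3, R₁ < ‖z‖ → ‖z‖ < R₂ → (‖z‖ < a' ∨ b' < ‖z‖) →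
          MetricCoord.hamAt (G c) (K c) z = 0 ∧
            ∀ Z : E3, MetricCoord.momFn b₀ (G c) (K c) z Z = 0) →
        (∀ (N : E3 → ℝ) (Y : E3 → E3),
          ContDiffOn ℝ ∞ N {z : E3 | a < ‖z‖ ∧ ‖z‖ < b} →
          ContDiffOn ℝ ∞ Y {z : E3 | a < ‖z‖ ∧ ‖z‖ < b} →
          (∀ z : E3, a < ‖z‖ → ‖z‖ < b →
            MetricCoord.adjHamG (G 0) (K 0) N z + MetricCoord.adjMomGS (G 0) (K 0) Y z = 0 ∧
            MetricCoord.adjHamK (G 0) (K 0) N z + MetricCoord.adjMomKS (G 0) Y z = 0) →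
          ∀ z : E3, a < ‖z‖ → ‖z‖ < b → N z = 0 ∧ Y z = 0) →
        ∃ (r : ℝ) (G' K' : EuclideanSpace ℝ (Fin 1) → E3 → E3 →L[ℝ] E3 →L[ℝ] ℝ), 0 < r ∧
          ContDiffOn ℝ ∞ (fun p : EuclideanSpace ℝ (Fin 1) × E3 ↦ G' p.1 p.2)
            (ball (0 : EuclideanSpace ℝ (Fin 1)) r ×ˢ {z : E3 | R₁ < ‖z‖ ∧ ‖z‖ < R₂}) ∧
          ContDiffOn ℝ ∞ (fun p : EuclideanSpace ℝ (Fin 1) × E3 ↦ K' p.1 p.2)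
            (ball (0 : EuclideanSpace ℝ (Fin 1)) r ×ˢ {z : E3 | R₁ < ‖z‖ ∧ ‖z‖ < R₂}) ∧
          (∀ c ∈ ball (0 : EuclideanSpace ℝ (Fin 1)) r, ∀ z : E3, R₁ < ‖z‖ → ‖z‖ < R₂ →
            ∀ v w : E3, G' c z v w = G' c z w v ∧ K' c z v w = K' c z w v) ∧
          (∀ c ∈ ball (0 : EuclideanSpace ℝ (Fin 1)) r, ∀ z : E3, R₁ < ‖z‖ → ‖z‖ < R₂ →
            ∀ v : E3, v ≠ 0 → 0 < G' c z v v) ∧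
          (∀ c ∈ ball (0 : EuclideanSpace ℝ (Fin 1)) r, ∀ z : E3, R₁ < ‖z‖ → ‖z‖ < R₂ →
            MetricCoord.hamAt (G' c) (K' c) z = 0 ∧
              ∀ Z : E3, MetricCoord.momFn b₀ (G' c) (K' c) z Z = 0) ∧
          (∀ z : E3, R₁ < ‖z‖ → ‖z‖ < R₂ → G' 0 z = G 0 z ∧ K' 0 z = K 0 z) ∧
          (∀ c ∈ ball (0 : EuclideanSpace ℝ (Fin 1)) r, ∀ z : E3, R₁ < ‖z‖ → ‖z‖ < R₂ →
            (‖z‖ < a ∨ b < ‖z‖) → G' c z = G c z ∧ K' c z = K c z)) :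
    ChruscielDelay_parametricAnnulusGluing := by
  refine ChruscielDelay_parametricAnnulusGluing_of_coordCore b₀ ?_
  intro R₁ R₂ hR₁ hR₁₂ S T hSs hTs hsym hpos hcv hKID
  -- the base member as coordinate data on `A`
  have hmaps : ∀ z ∈ {z : E3 | R₁ < ‖z‖ ∧ ‖z‖ < R₂},
      ((0 : EuclideanSpace ℝ (Fin 1)), z) ∈
        (univ : Set (EuclideanSpace ℝ (Fin 1))) ×ˢ {z : E3 | R₁ < ‖z‖ ∧ ‖z‖ < R₂} :=
    fun z hz ↦ ⟨mem_univ _, hz⟩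
  have hS0 : ContDiffOn ℝ ∞ (S 0) {z : E3 | R₁ < ‖z‖ ∧ ‖z‖ < R₂} :=
    hSs.comp (contDiffOn_const.prodMk contDiffOn_id) hmaps
  have hT0 : ContDiffOn ℝ ∞ (T 0) {z : E3 | R₁ < ‖z‖ ∧ ‖z‖ < R₂} :=
    hTs.comp (contDiffOn_const.prodMk contDiffOn_id) hmaps
  -- (K): a KID-free sub-annulus `{a < ‖z‖ < b}`
  obtain ⟨a, b, ha, hab, hb, hKIDab⟩ := hK R₁ R₂ hR₁ hR₁₂ (S 0) (T 0) hS0 hT0 (hsym 0) (hpos 0)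
    (hcv 0) hKID
  -- the cut-off radii `a < a' < b' < b` and the interpolated family
  obtain ⟨a', b', ha', hab', hb'⟩ : ∃ a' b' : ℝ, a < a' ∧ a' < b' ∧ b' < b :=
    ⟨a + (b - a) / 3, b - (b - a) / 3, by linarith, by linarith, by linarith⟩
  obtain ⟨G, K, hGs, hKs, hGsym, hGpos, hG0, hGin, hGout, hGcv0, hGcv⟩ :=
    exists_interpolatedCoordFamily b₀ hR₁ (ha.trans ha') hab' S T hSs hTs hsym hpos hcv
  -- `(G 0, K 0) = (S 0, T 0)` has no KIDs on the sub-annulus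
  have hKIDG : ∀ (N : E3 → ℝ) (Y : E3 → E3),
      ContDiffOn ℝ ∞ N {z : E3 | a < ‖z‖ ∧ ‖z‖ < b} →
      ContDiffOn ℝ ∞ Y {z : E3 | a < ‖z‖ ∧ ‖z‖ < b} →
      (∀ z : E3, a < ‖z‖ → ‖z‖ < b →
        MetricCoord.adjHamG (G 0) (K 0) N z + MetricCoord.adjMomGS (G 0) (K 0) Y z = 0 ∧
        MetricCoord.adjHamK (G 0) (K 0) N z + MetricCoord.adjMomKS (G 0) Y z = 0) →
      ∀ z : E3, a < ‖z‖ → ‖z‖ < b → N z = 0 ∧ Y z = 0 := by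
    intro N Y hN hY heq
    have hevG : ∀ z : E3, G 0 =ᶠ[𝓝 z] S 0 := fun z ↦ Eventually.of_forall fun w ↦ (hG0 w).1
    have hevK : ∀ z : E3, K 0 =ᶠ[𝓝 z] T 0 := fun z ↦ Eventually.of_forall fun w ↦ (hG0 w).2
    refine hKIDab N Y hN hY fun z hz1 hz2 ↦ ?_
    obtain ⟨h1, h2⟩ := heq z hz1 hz2
    rw [MetricCoord.adjHamG_congr_of_eventuallyEq (hevG z) (hevK z) EventuallyEq.rfl,
      MetricCoord.adjMomGS_congr_of_eventuallyEq (hevG z) (hevK z) EventuallyEq.rfl] at h1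
    rw [MetricCoord.adjHamK_congr_of_eventuallyEq (hevG z) (hevK z) EventuallyEq.rfl,
      MetricCoord.adjMomKS_congr_of_eventuallyEq (hevG z) (EventuallyEq.rfl (f := Y))] at h2
    exact ⟨h1, h2⟩
  -- (E): the corrected family on `A`
  obtain ⟨r, G', K', hr, hG's, hK's, hsym', hpos', hcv', h0', hoff'⟩ :=
    hE R₁ a a' b' b R₂ hR₁ ha ha' hab' hb' hb G K hGs hKs hGsym hGpos hGcv0 hGcv hKIDG
  refine ⟨r, a, b, G', K', hr, ha, hab, hb, hG's, hK's, hsym', hpos', hcv', ?_, ?_, ?_⟩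
  · intro z hz1 hz2
    obtain ⟨h1, h2⟩ := h0' z hz1 hz2
    exact ⟨h1.trans (hG0 z).1, h2.trans (hG0 z).2⟩
  · intro c hc z hz1 hz2
    obtain ⟨h1, h2⟩ := hoff' c hc z hz1 (by linarith) (Or.inl hz2)
    obtain ⟨h3, h4⟩ := hGin c z (by linarith)
    exact ⟨h1.trans h3, h2.trans h4⟩
  · intro c hc z hz1 hz2
    obtain ⟨h1, h2⟩ := hoff' c hc z (by linarith) hz2 (Or.inr hz1)
    obtain ⟨h3, h4⟩ := hGout c z (by linarith)
    exact ⟨h1.trans h3, h2.trans h4⟩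

end Literature.Geometry.Lorentzian

end
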